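/-
Copyright (c) 2026 the pub-hodgecm-mathlib formalisation cell (harness21).  Prover seat hodgecm-mathlib-K2Liu-p10 (g0), Track B «K2-LIT»,
#184♮ = hLiu418 = `stmt-HodgeConjecture-24832`; LEAD F0P6-plan (g12) DEAL 2026-09-04T06:17:21Z «WA» (SIGS-RoadI-v3 §2 U2d, M-156d (R-res)):
file WA-0 — the CONSUMED forms (W1) «`H(L)·H(𝔸_f)` is dense in `H(𝔸)`» and (W2) «a continuous left-`H(L)`-invariant function vanishing on `H(𝔸_f)` is zero»,
BY VALUE on the archimedean density `DenseRange rationalToArch` (real weak approximation, files WA-1…WA-3).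
-/
import Literature.NumberTheory.GelbartRogawski1991.DoubledUnitaryGlobalSplittingData   -- ★ `HA`, `ratH`, `hermD`
import Literature.NumberTheory.Automorphic.UnitaryGroupAdelicLift                     -- ★ `archPart_toAdelic'` (+ `adelicProdEquiv`, `rationalToArch`)
import HarnessLib

/-!
# Crux `HLiu418`, road `K2_Liu` (Road I v3, U2d «WA»): WEAK APPROXIMATION IN THE CONSUMED FORM — `H(L)·H(𝔸_f)` dense in `H(𝔸)`,
# and the vanishing corollary, by value on the archimedean density of `H(L)`

Cell `hodgecm-mathlib`, crux item hLiu418 = `stmt-HodgeConjecture-24832`; squad K2, LEAD F0P6-plan (g12) (deal 2026-09-04T06:17:21Z), box K2E5-r01 (g6),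
sheet K2E5-plan (g5) `SIGS-RoadI-v3` §2 U2d.  THEOREMS ONLY (no `def`, no instance, no notation, no named-fact hypothesis, no `sorry`); lane
`--supports stmt-HodgeConjecture-24832 --as helper` (count-neutral helper).

SETTING.  `E/F` number fields, `c : E ≃ₐ[F] E`, `J ∈ M_N(E)`; the tree's carriers `U(J)(𝔸_F) = (adelicGroupData F E c N J).Adelic`, `U(J)(F) = rational`,
`toAdelic`, `archPart ∕ finPart ∕ archToAdelic ∕ finAdelicToAdelic` (★ `UnitaryGroupAdelicProduct`: `U(J)(𝔸) ≃ₜ* U(J)(E ⊗ ℝ) × U(J)(𝔸_f)`), and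
`rationalToArch : U(J)(F) →* U(J)(E ⊗ ℝ)` (★ `archPart_toAdelic : (γ)_∞ = rationalToArch γ`).  The ARCHIMEDEAN DENSITY «`U(J)(F)` is dense in `U(J)(E ⊗ ℝ)`»
(real weak approximation, [PlatonovRapinchuk1994, §7.1 Prop. 7.11 ∕ Thm. 7.7]) enters BY VALUE as `hWA : DenseRange (rationalToArch F E c N J)`; it is
discharged for the doubled unitary group of a CM field by the sequel files (Lie-algebra density, Cayley transform, central unit scalars).
* §1 (generic) **`exists_toAdelic_mul_mem_of_isOpen`** (W1): every non-empty open `U ⊆ U(J)(𝔸)` contains `γ · h` with `γ ∈ U(J)(F)`, `h_∞ = 1`;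
  **`eq_zero_of_toAdelic_invariant_of_archPart_eq_one`** (W2): a continuous `Φ : U(J)(𝔸) → Y` (`Y` a `T₁` space with `0`) with `Φ(γ·h) = Φ(h)` and `Φ(h) = 0`
  whenever `h_∞ = 1` vanishes identically.
* §2 (the doubled group of the socket, `H(𝔸) = HA L e dV hdV dW hdW`, `ratH = range toAdelic`) **`dense_ratH_mul_ofFinite`**, **`eq_zero_of_ratH_invariant_of_vanish_ofFinite`**.
[PlatonovRapinchuk1994, §7.1] [BorelJacquet1979, §4.1].
HONEST LABEL.  Count-neutral helper; `HC_CM` is proved only modulo the 7 printed citations (2 remaining named inputs: hLiu418 = `stmt-HodgeConjecture-24832`,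
h413 = `stmt-HodgeConjecture-24833`) until rung 0 closes.
-/

set_option autoImplicit false
set_option linter.dupNamespace false -- the mandated namespace repeats `HodgeConjecture.HodgeConjecture`

noncomputable section

namespace Summit.HodgeConjecture.HodgeConjecture.Cruxes.HLiu418.K2LiuWeakApproximationDensity

open Topology Filter Set Function
open NumberField NumberField.mixedEmbedding IsDedekindDomain
open Literature.NumberTheory.Automorphic Literature.NumberTheory.Automorphic.UnitaryGroup
open Literature.NumberTheory.GelbartRogawski1991 Literature.NumberTheory.GelbartRogawski1991.GRConstruction

/-! ## §1 Generic: `U(J)(F) · U(J)(𝔸_f)` is dense in `U(J)(𝔸)` when `U(J)(F)` is dense at `∞` -/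

section Generic

variable (F E : Type) [Field F] [NumberField F] [Field E] [NumberField E] [Algebra F E]
  (c : E ≃ₐ[F] E) (N : ℕ) (J : Matrix (Fin N) (Fin N) E)

/-- **(W1) `U(J)(F) · U(J)(𝔸_f)` is DENSE in `U(J)(𝔸)`** given real weak approximation at `∞`: every non-empty open `U ⊆ U(J)(𝔸)` contains `γ · h` with
`γ ∈ U(J)(F)` and `h_∞ = 1` (slice `U` along `a ↦ (a, 1)·(1, x_f)` through a point `x ∈ U`, approximate `x_∞` by some `γ_∞ = rationalToArch γ`, and put
`h := γ⁻¹ · (γ_∞, 1) · (1, x_f)`).  Typed on the datum `(adelicGroupData F E c N J).Adelic` (the currency of ★ `archPart ∕ archToAdelic ∕ finAdelicToAdelic`).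
[cite: PlatonovRapinchuk1994, §7.1 Prop. 7.11] [cite: BorelJacquet1979, §4.1] -/
theorem exists_toAdelic_mul_mem_of_isOpen (hWA : DenseRange (rationalToArch F E c N J))
    {U : Set (adelicGroupData F E c N J).Adelic} (hU : IsOpen U) (hne : U.Nonempty) :
    ∃ γ : rational F E c N J, ∃ h : (adelicGroupData F E c N J).Adelic,
      archPart F E c N J h = 1 ∧ (adelicGroupData F E c N J).toAdelic γ * h ∈ U := by
  obtain ⟨x, hx⟩ := hne
  -- the archimedean slice of `U` through `x`
  have hsl : Continuous fun a : arch F E c N J => archToAdelic F E c N J a * finAdelicToAdelic F E c N J (finPart F E c N J x) :=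
    (continuous_archToAdelic F E c N J).mul continuous_const
  have hxV : archPart F E c N J x ∈ (fun a : arch F E c N J => archToAdelic F E c N J a * finAdelicToAdelic F E c N J (finPart F E c N J x)) ⁻¹' U := by
    rw [Set.mem_preimage, archToAdelic_mul_finAdelicToAdelic]
    exact hx
  obtain ⟨γ, hγV⟩ := hWA.exists_mem_open (hU.preimage hsl) ⟨_, hxV⟩
  rw [Set.mem_preimage] at hγV
  refine ⟨γ, ((adelicGroupData F E c N J).toAdelic γ)⁻¹ *
      (archToAdelic F E c N J (rationalToArch F E c N J γ) * finAdelicToAdelic F E c N J (finPart F E c N J x)), ?_, ?_⟩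
  · rw [map_mul, map_inv, map_mul, archPart_toAdelic', archPart_archToAdelic, archPart_finAdelicToAdelic, mul_one, inv_mul_cancel]
  · rw [mul_inv_cancel_left]
    exact hγV

/-- **(W2) a continuous left-`U(J)(F)`-invariant function on `U(J)(𝔸)` vanishing at every `h` with `h_∞ = 1` is identically zero**
(it vanishes on the dense set `U(J)(F)·U(J)(𝔸_f)` by invariance, and its zero set is closed). [cite: PlatonovRapinchuk1994, §7.1 Prop. 7.11] [cite: BorelJacquet1979, §4.1] -/
theorem eq_zero_of_toAdelic_invariant_of_archPart_eq_one (hWA : DenseRange (rationalToArch F E c N J))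
    {Y : Type*} [TopologicalSpace Y] [T1Space Y] [Zero Y] (Φ : (adelicGroupData F E c N J).Adelic → Y) (hΦ : Continuous Φ)
    (hγ : ∀ γ : rational F E c N J, ∀ h, Φ ((adelicGroupData F E c N J).toAdelic γ * h) = Φ h) (h0 : ∀ h, archPart F E c N J h = 1 → Φ h = 0) :
    Φ = 0 := by
  funext x
  by_contra hx
  obtain ⟨γ, h, h1, hmem⟩ := exists_toAdelic_mul_mem_of_isOpen F E c N J hWA (isClosed_singleton.preimage hΦ).isOpen_compl ⟨x, hx⟩
  exact hmem (by rw [Set.mem_preimage, hγ, h0 h h1]; rfl)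

end Generic

/-! ## §2 The doubled unitary group of the socket: `ratH · H(𝔸_f)` dense in `H(𝔸)` -/

section Doubled

variable (L : Type) [Field L] [NumberField L] [IsCMField L]
variable {N M n : ℕ} (e : Fin N × Fin M ≃ Fin n)
  (dV : Fin N → L) (hdV : ∀ i, IsCMField.complexConj L (dV i) = dV i)
  (dW : Fin M → L) (hdW : ∀ i, IsCMField.complexConj L (dW i) = dW i)

/-- **(W1) for `H(𝔸) = U(J^𝔻)(𝔸_{L⁺})`** (the socket's `HA`, `ratH = range toAdelic`): given real weak approximation for `H`, every non-empty open
`U ⊆ H(𝔸)` meets `ratH · {h | h_∞ = 1}`. [cite: PlatonovRapinchuk1994, §7.1 Prop. 7.11] [cite: BorelJacquet1979, §4.1] -/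
theorem dense_ratH_mul_ofFinite
    (hWA : DenseRange (rationalToArch (Fp L) L (IsCMField.complexConj L) (n + n) (hermD L e dV hdV dW hdW)))
    {U : Set (HA L e dV hdV dW hdW)} (hU : IsOpen U) (hne : U.Nonempty) :
    ∃ γ ∈ ratH L e dV hdV dW hdW, ∃ h : HA L e dV hdV dW hdW,
      archPart (Fp L) L (IsCMField.complexConj L) (n + n) (hermD L e dV hdV dW hdW) h = 1 ∧ γ * h ∈ U := by
  obtain ⟨γ, h, h1, hmem⟩ := exists_toAdelic_mul_mem_of_isOpen (Fp L) L (IsCMField.complexConj L) (n + n) (hermD L e dV hdV dW hdW) hWA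
    (U := U) hU hne
  exact ⟨_, ⟨γ, rfl⟩, h, h1, hmem⟩

/-- **(W2) for `H(𝔸)`**: a continuous `Φ : H(𝔸) → ℂ`, left-`ratH`-invariant and vanishing at every `h` with `h_∞ = 1`, is zero.
[cite: PlatonovRapinchuk1994, §7.1 Prop. 7.11] [cite: BorelJacquet1979, §4.1] -/
theorem eq_zero_of_ratH_invariant_of_vanish_ofFinite
    (hWA : DenseRange (rationalToArch (Fp L) L (IsCMField.complexConj L) (n + n) (hermD L e dV hdV dW hdW)))
    (Φ : HA L e dV hdV dW hdW → ℂ) (hΦ : Continuous Φ) (hγ : ∀ γ ∈ ratH L e dV hdV dW hdW, ∀ h, Φ (γ * h) = Φ h)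
    (h0 : ∀ h, archPart (Fp L) L (IsCMField.complexConj L) (n + n) (hermD L e dV hdV dW hdW) h = 1 → Φ h = 0) : Φ = 0 :=
  eq_zero_of_toAdelic_invariant_of_archPart_eq_one (Fp L) L (IsCMField.complexConj L) (n + n) (hermD L e dV hdV dW hdW) hWA Φ hΦ
    (fun γ h => hγ _ ⟨γ, rfl⟩ h) h0

end Doubled

end Summit.HodgeConjecture.HodgeConjecture.Cruxes.HLiu418.K2LiuWeakApproximationDensity
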